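import Summits.CriticalPhenomena.Ising3DConformalLimit.Theorems.PerfectScreeningGaussianLimitNotScreenedRegressionDefs
import Literature.Probability.LatticeModels.PlusStateFKG
import Literature.Probability.LatticeModels.MagnetizationContinuity
import Mathlib.MeasureTheory.Function.ConditionalExpectation.Real
import Mathlib.MeasureTheory.Function.ConditionalExpectation.PullOut
import HarnessLib

/-!
# Regression moments of the deep-spin regression (stub M2)

Stub `stub_regressionMoments` (M2) of line `single-layer-linear-regression` for the crux
`GaussianLimitNotScreened` (stmt-CriticalPhenomena-13886). THEOREM-ONLY; Mathlib/tree plumbing.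

With `μ_L = boxMeasure L` (the critical plus measure of the box `[-L,L]³`),
`m_L = regression n L = E_L[σ_{(n,0,0)} | layer]` (Mathlib `condExp` w.r.t. the cylinder σ-algebra
`layerEvents` of the plane `{x₀ = 0}`) and `ℓ = linStat s c = Σ_{u∈s} c_u σ_{(0,u)}`:

* (a) `msResidual n s c L = E_L[m_L²] − 2 Σ_u c_u ⟨σ_{(n,0,0)}σ_{(0,u)}⟩_L + Σ_{u,v} c_u c_v
  ⟨σ_{(0,u)}σ_{(0,v)}⟩_L` EXACTLY, for every `n, s, c, L`: expand the square (all integrands are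
  bounded on a probability space, `|m_L| ≤ 1` a.e. by `ae_bdd_abs_condExp_of_ae_bdd_abs`) and use the tower /
  pull-out property `E_L[m_L σ_{(0,u)}] = E_L[σ_{(n,0,0)} σ_{(0,u)}]` (`σ_{(0,u)}` is
  `layerEvents`-measurable: `condExp_mul_of_stronglyMeasurable_right` + `integral_condExp`);
* (b) the thermodynamic limit of the box plus-state pair expectations,
  `⟨σ_xσ_y⟩⁺_{[-L,L]³; β_c} → ⟨σ₀σ_{y−x}⟩⁺_{β_c} = criticalTwoPoint 3 (y − x)`
  (`tendsto_isingExpect_plus_spinPair hasBoxLimit_isingCorr_plus_holds` and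
  `plusPair_eq_twoPointPlus_sub`; `criticalTwoPoint d = twoPointPlus d (criticalBeta d)` by definition).

References: S. Friedli, Y. Velenik, *Statistical Mechanics of Lattice Systems* (2017), Thm. 3.17
[FriedliVelenik2017].
-/

noncomputable section

namespace Summit.CriticalPhenomena.Ising3DConformalLimit.Cruxes.GaussianLimitNotScreened.SingleLayerLinearRegression

open MeasureTheory Filter Topology
open Literature.Probability.LatticeModels

/-! ### Finite-volume bookkeeping: the box plus measure, spins, the regression -/

/-- The critical box plus measure `μ_L` is a probability measure (tree instance for `isingMeasure`).
[folklore] -/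
theorem regressionMoments_isProbabilityMeasure (L : ℕ) : IsProbabilityMeasure (boxMeasure L) := by
  unfold boxMeasure
  infer_instance

/-- `‖σ_x‖ ≤ 1`. [folklore] -/
theorem regressionMoments_norm_spinAt_le_one (x : Site 3) (σ : SpinConfig (Site 3)) :
    ‖spinAt x σ‖ ≤ 1 := by
  rw [Real.norm_eq_abs, abs_spinAt]

/-- Spins are integrable under `μ_L`. [folklore] -/
theorem regressionMoments_integrable_spinAt (L : ℕ) (x : Site 3) :
    Integrable (spinAt x) (boxMeasure L) := by
  haveI := regressionMoments_isProbabilityMeasure L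
  exact Integrable.of_bound (measurable_spinAt x).aestronglyMeasurable 1
    (Eventually.of_forall (regressionMoments_norm_spinAt_le_one x))

/-- `f σ_x` is `μ_L`-integrable for `μ_L`-integrable `f` (a spin is bounded by `1`). [folklore] -/
theorem regressionMoments_integrable_mul_spinAt {L : ℕ} {f : SpinConfig (Site 3) → ℝ}
    (hf : Integrable f (boxMeasure L)) (x : Site 3) :
    Integrable (fun σ => f σ * spinAt x σ) (boxMeasure L) :=
  hf.mul_bdd (measurable_spinAt x).aestronglyMeasurable
    (Eventually.of_forall (regressionMoments_norm_spinAt_le_one x))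

/-- The finite-volume plus pair expectation `⟨σ_xσ_y⟩_L` is the `μ_L`-integral of `σ_x σ_y`
(definitional unfolding of `isingExpect`, `spinPair`, `boxMeasure`). [folklore] -/
theorem regressionMoments_isingExpect_spinPair (L : ℕ) (x y : Site 3) :
    isingExpect (zdGraph 3) (box 3 L) (criticalBeta 3) 0 BoundaryCondition.plus (spinPair x y) =
      ∫ σ, spinAt x σ * spinAt y σ ∂(boxMeasure L) :=
  rfl

/-- The regression `m_L = E_L[σ_{(n,0,0)} | layer]` is `μ_L`-integrable (`integrable_condExp`).
[folklore] -/
theorem regressionMoments_integrable_regression (n L : ℕ) :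
    Integrable (regression n L) (boxMeasure L) := by
  unfold regression
  exact integrable_condExp

/-- `|m_L| ≤ 1` `μ_L`-a.e. (`ae_bdd_abs_condExp_of_ae_bdd_abs` with `|σ_{(n,0,0)}| ≤ 1`). [folklore] -/
theorem regressionMoments_ae_norm_le_one (n L : ℕ) :
    ∀ᵐ σ ∂(boxMeasure L), ‖regression n L σ‖ ≤ 1 := by
  have hbdd : ∀ᵐ σ ∂(boxMeasure L), |spinAt (deepSite n) σ| ≤ (1 : ℝ) :=
    Eventually.of_forall fun σ => (abs_spinAt _ σ).le
  have h := ae_bdd_abs_condExp_of_ae_bdd_abs (m := layerEvents) hbdd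
  filter_upwards [h] with σ hσ
  rw [Real.norm_eq_abs]
  simpa only [regression] using hσ

/-- `∫ m_L² dμ_L` makes sense: `m_L²` is `μ_L`-integrable. [folklore] -/
theorem regressionMoments_integrable_sq (n L : ℕ) :
    Integrable (fun σ => regression n L σ ^ 2) (boxMeasure L) := by
  have h : Integrable (fun σ => regression n L σ * regression n L σ) (boxMeasure L) :=
    (regressionMoments_integrable_regression n L).bdd_mul
      (regressionMoments_integrable_regression n L).aestronglyMeasurable
      (regressionMoments_ae_norm_le_one n L)
  exact h.congr (Eventually.of_forall fun σ => (sq (regression n L σ)).symm)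

/-- The layer spin `σ_{(0,u)}` is measurable for the layer σ-algebra `layerEvents`
(`(0,u) ∈ {y | y₀ = 0}`; Mathlib `measurable_cylinderEvent_apply`). [folklore] -/
theorem regressionMoments_measurable_layer_spinAt (u : Fin 2 → ℤ) :
    Measurable[layerEvents] (spinAt (layerSite u)) := by
  have hu : layerSite u ∈ {y : Site 3 | y 0 = 0} := by simp [layerSite]
  exact (Measurable.of_discrete (f := fun v : ℤˣ => ((v : ℤ) : ℝ))).comp
    (measurable_cylinderEvent_apply (X := fun _ : Site 3 => ℤˣ) hu)

/-- **Tower / pull-out property** `E_L[m_L σ_{(0,u)}] = E_L[σ_{(n,0,0)} σ_{(0,u)}]`: `σ_{(0,u)}` is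
`layerEvents`-measurable and bounded, so `E_L[σ_{(n,0,0)}σ_{(0,u)} | layer] = m_L σ_{(0,u)}` a.e.
(`condExp_mul_of_stronglyMeasurable_right`), and `∫ E_L[· | layer] dμ_L = ∫ · dμ_L`
(`integral_condExp`). [folklore] -/
theorem regressionMoments_tower (n L : ℕ) (u : Fin 2 → ℤ) :
    ∫ σ, regression n L σ * spinAt (layerSite u) σ ∂(boxMeasure L) =
      ∫ σ, spinAt (deepSite n) σ * spinAt (layerSite u) σ ∂(boxMeasure L) := by
  haveI := regressionMoments_isProbabilityMeasure L
  have hg : StronglyMeasurable[layerEvents] (spinAt (layerSite u)) :=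
    (regressionMoments_measurable_layer_spinAt u).stronglyMeasurable
  have hf : Integrable (spinAt (deepSite n)) (boxMeasure L) :=
    regressionMoments_integrable_spinAt L _
  have hfg : Integrable (spinAt (deepSite n) * spinAt (layerSite u)) (boxMeasure L) :=
    regressionMoments_integrable_mul_spinAt hf (layerSite u)
  have hpull := condExp_mul_of_stronglyMeasurable_right (μ := boxMeasure L) hg hfg hf
  calc ∫ σ, regression n L σ * spinAt (layerSite u) σ ∂(boxMeasure L)
      = ∫ σ, ((boxMeasure L)[spinAt (deepSite n) * spinAt (layerSite u)|layerEvents]) σ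
          ∂(boxMeasure L) := by
        refine integral_congr_ae ?_
        filter_upwards [hpull] with σ hσ
        rw [hσ, Pi.mul_apply]
        rfl
    _ = ∫ σ, spinAt (deepSite n) σ * spinAt (layerSite u) σ ∂(boxMeasure L) :=
        integral_condExp cylinderEvents_le_pi

/-! ### Expanding the square -/

/-- Algebra of the mean-square residual of a linear statistic: for integrable `m²`, `m gᵢ`, `gᵢ gⱼ`,
`∫ (m − Σ cᵢgᵢ)² = ∫ m² − 2 Σ cᵢ ∫ m gᵢ + Σᵢⱼ cᵢcⱼ ∫ gᵢgⱼ`. [folklore] -/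
theorem regressionMoments_integral_sub_linComb_sq {Ω ι : Type*} [MeasurableSpace Ω]
    (μ : Measure Ω) (s : Finset ι) (c : ι → ℝ) {m : Ω → ℝ} {g : ι → Ω → ℝ}
    (hm2 : Integrable (fun ω => m ω ^ 2) μ)
    (hmg : ∀ i, Integrable (fun ω => m ω * g i ω) μ)
    (hgg : ∀ i j, Integrable (fun ω => g i ω * g j ω) μ) :
    ∫ ω, (m ω - ∑ i ∈ s, c i * g i ω) ^ 2 ∂μ =
      (∫ ω, m ω ^ 2 ∂μ) - 2 * ∑ i ∈ s, c i * (∫ ω, m ω * g i ω ∂μ)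
        + ∑ i ∈ s, ∑ j ∈ s, c i * c j * (∫ ω, g i ω * g j ω ∂μ) := by
  have hS1 : Integrable (fun ω => ∑ i ∈ s, c i * (m ω * g i ω)) μ :=
    integrable_finsetSum s fun i _ => (hmg i).const_mul (c i)
  have h2S1 : Integrable (fun ω => 2 * ∑ i ∈ s, c i * (m ω * g i ω)) μ := hS1.const_mul 2
  have hS2 : Integrable (fun ω => ∑ i ∈ s, ∑ j ∈ s, c i * c j * (g i ω * g j ω)) μ :=
    integrable_finsetSum s fun i _ => integrable_finsetSum s fun j _ => (hgg i j).const_mul _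
  have h12 : Integrable
      (fun ω => m ω ^ 2 - 2 * ∑ i ∈ s, c i * (m ω * g i ω)) μ := hm2.sub h2S1
  have hexp : ∀ ω, (m ω - ∑ i ∈ s, c i * g i ω) ^ 2 =
      m ω ^ 2 - 2 * (∑ i ∈ s, c i * (m ω * g i ω))
        + ∑ i ∈ s, ∑ j ∈ s, c i * c j * (g i ω * g j ω) := by
    intro ω
    have h1 : m ω * ∑ i ∈ s, c i * g i ω = ∑ i ∈ s, c i * (m ω * g i ω) := by
      rw [Finset.mul_sum]
      exact Finset.sum_congr rfl fun i _ => by ring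
    have h2 : (∑ i ∈ s, c i * g i ω) ^ 2 =
        ∑ i ∈ s, ∑ j ∈ s, c i * c j * (g i ω * g j ω) := by
      rw [sq, Finset.sum_mul_sum]
      exact Finset.sum_congr rfl fun i _ => Finset.sum_congr rfl fun j _ => by ring
    rw [sub_sq, mul_assoc, h1, h2]
  have hI1 : ∫ ω, (∑ i ∈ s, c i * (m ω * g i ω)) ∂μ =
      ∑ i ∈ s, c i * (∫ ω, m ω * g i ω ∂μ) := by
    rw [integral_finsetSum s fun i _ => (hmg i).const_mul (c i)]
    exact Finset.sum_congr rfl fun i _ => integral_const_mul _ _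
  have hI2 : ∫ ω, (∑ i ∈ s, ∑ j ∈ s, c i * c j * (g i ω * g j ω)) ∂μ =
      ∑ i ∈ s, ∑ j ∈ s, c i * c j * (∫ ω, g i ω * g j ω ∂μ) := by
    rw [integral_finsetSum s fun i _ => integrable_finsetSum s fun j _ => (hgg i j).const_mul _]
    refine Finset.sum_congr rfl fun i _ => ?_
    rw [integral_finsetSum s fun j _ => (hgg i j).const_mul _]
    exact Finset.sum_congr rfl fun j _ => integral_const_mul _ _
  simp_rw [hexp]
  rw [integral_add h12 hS2, integral_sub hm2 h2S1, integral_const_mul, hI1, hI2]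

/-! ### The registered stub -/

/-- **stub M2 — REGRESSION MOMENTS: tower property and box limits.** (a) For every `n, s, c, L`:
expanding the square in `msResidual` and using the tower property
`E_L[m_L σ_{(0,u)}] = E_L[σ_{(n,0,0)} σ_{(0,u)}]` (`σ_{(0,u)}` is `layerEvents`-measurable and bounded:
`condExp_mul_of_stronglyMeasurable_right` / `integral_condExp`; all integrands bounded on a probability
space, `|m_L| ≤ 1` a.e. by `ae_bdd_abs_condExp_of_ae_bdd_abs`) gives `msResidual n s c L = E_L[m_L²] − 2Σ_u c_u
⟨σ_{(n,0,0)}σ_{(0,u)}⟩_L + Σ_{u,v} c_uc_v ⟨σ_{(0,u)}σ_{(0,v)}⟩_L` EXACTLY; (b) the thermodynamic limit of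
box plus-state pair expectations, `⟨σ_xσ_y⟩_{[-L,L]³}^+ → ⟨σ₀σ_{y−x}⟩⁺_{β_c}`
(`tendsto_isingExpect_plus_spinPair hasBoxLimit_isingCorr_plus_holds` + `plusPair_eq_twoPointPlus_sub`;
`criticalTwoPoint = twoPointPlus _ (criticalBeta 3)` by definition). [cite: FriedliVelenik2017, Thm. 3.17] -/
theorem stub_regressionMoments :
    (∀ (n : ℕ) (s : Finset (Fin 2 → ℤ)) (c : (Fin 2 → ℤ) → ℝ) (L : ℕ),
      msResidual n s c L =
        (∫ σ, regression n L σ ^ 2 ∂(boxMeasure L))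
          - 2 * ∑ u ∈ s, c u * isingExpect (zdGraph 3) (box 3 L) (criticalBeta 3) 0 BoundaryCondition.plus
              (spinPair (deepSite n) (layerSite u))
          + ∑ u ∈ s, ∑ v ∈ s, c u * c v * isingExpect (zdGraph 3) (box 3 L) (criticalBeta 3) 0
              BoundaryCondition.plus (spinPair (layerSite u) (layerSite v))) ∧
    (∀ x y : Site 3, Tendsto (fun L : ℕ => isingExpect (zdGraph 3) (box 3 L) (criticalBeta 3) 0
        BoundaryCondition.plus (spinPair x y)) atTop (𝓝 (criticalTwoPoint 3 (y - x)))) := by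
  refine ⟨fun n s c L => ?_, fun x y => ?_⟩
  · have h := regressionMoments_integral_sub_linComb_sq (boxMeasure L) s c (m := regression n L)
      (g := fun u => spinAt (layerSite u)) (regressionMoments_integrable_sq n L)
      (fun u => regressionMoments_integrable_mul_spinAt
        (regressionMoments_integrable_regression n L) (layerSite u))
      (fun u v => regressionMoments_integrable_mul_spinAt
        (regressionMoments_integrable_spinAt L (layerSite u)) (layerSite v))
    simp only [regressionMoments_tower] at h
    simpa only [msResidual, linStat, regressionMoments_isingExpect_spinPair] using h
  · have h := tendsto_isingExpect_plus_spinPair (d := 3) hasBoxLimit_isingCorr_plus_holds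
      (criticalBeta_nonneg 3) x y
    rw [plusPair_eq_twoPointPlus_sub (criticalBeta_nonneg 3) x y] at h
    simpa only [criticalTwoPoint] using h

end Summit.CriticalPhenomena.Ising3DConformalLimit.Cruxes.GaussianLimitNotScreened.SingleLayerLinearRegression

end
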